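import Mathlib
import Summits.AtomisticToContinuum.FouriersLaw.Theorems.EmbeddedDrudeMourreMourreDissolutionLevelShiftPushforward
import HarnessLib

/-!
# Calculus on the period cell `(−π,π]³`: coordinate swaps and periodic integration by parts
(crux `EmbeddedDrudeMourre.DrudeDissolution`, item stmt-AtomisticToContinuum-12593; `--supports` file for the
registered sub-goal `cell_integral_mul_fderiv_eq_neg` of stub B1b″ `stub_excursionSecondDifference` of line
`kinetic-polymer-gas-on-the-time-axis`; closes nothing; lead c13 (process B), 2026-08-17)

WHAT. The cell of the bracket-weighted two-phonon density of states `m_f = Ω_*(W dk)` is the iterated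
product `μc = (vol|(−π,π]) ⊗ ((vol|(−π,π]) ⊗ (vol|(−π,π]))` on `ℝ × ℝ × ℝ`, read at `p = (k₁,(k₃,k₂))`.
This file provides the torus calculus used by the second-difference estimates of stub B1b″ WITHOUT
unfolding the cell to `ℝ³`:
* `cell_measurePreserving_swap23`, `cell_measurePreserving_swap12` — the coordinate swaps preserve `μc`;
* `cell_integral_mul_fderiv_inner_eq_neg` — periodic integration by parts in the innermost coordinate:
  `∫ f ∂₃g dμc = −∫ ∂₃f g dμc` for `C¹` functions `f, g` that are `2π`-periodic in `p.2.2`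
  (`∂₃ = fderiv · (0,0,1)`; Fubini `levelShift_integral_cell` + the interval formula, the boundary
  terms cancelling by periodicity);
* `cell_integral_mul_fderiv_mid_eq_neg`, `cell_integral_mul_fderiv_fst_eq_neg` — the same in the
  directions `(0,1,0)` and `(1,0,0)` (transport by the swaps, which are linear isometries of `ℝ³`);
* `cell_integral_mul_fderiv_eq_neg` — the three directions packaged over the coordinate vectors
  (registered sub-goal).

WHY (role). Two such integrations by parts along the vector field `∇Ω/|∇Ω|²` (a sum over the three
coordinate directions) turn `∫ W χ · φ″(Ω)` into `∫ (L†L†(Wχ)) · φ(Ω)` on the cell, which is the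
`O(δ²)` mechanism of B1b″ away from the critical set of `Ω`; all amplitudes there (`W`, `Ω`, the cutoffs
`χ` built from `cos kⱼ`, `sin kⱼ`) are `2π`-periodic real-analytic functions on `ℝ³`, so periodic
boundary terms — not compact support — are the natural setting.
-/

noncomputable section

open MeasureTheory Set Filter Function Topology Real
open scoped Topology ContDiff

namespace Summit.AtomisticToContinuum.FouriersLaw.Theorems.DrudeDissolution.KineticPolymerGasOnTheTimeAxis

/-! ### §1 Coordinate swaps preserve the cell measure -/

/-- The swap of the two inner coordinates `(x,(y,z)) ↦ (x,(z,y))` preserves the cell measure.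
[folklore] -/
theorem cell_measurePreserving_swap23 :
    MeasurePreserving (fun q : ℝ × ℝ × ℝ => (q.1, q.2.2, q.2.1)) ((volume.restrict (Set.Ioc (-Real.pi) Real.pi)).prod ((volume.restrict (Set.Ioc (-Real.pi) Real.pi)).prod (volume.restrict (Set.Ioc (-Real.pi) Real.pi)))) ((volume.restrict (Set.Ioc (-Real.pi) Real.pi)).prod ((volume.restrict (Set.Ioc (-Real.pi) Real.pi)).prod (volume.restrict (Set.Ioc (-Real.pi) Real.pi)))) := by
  have h : MeasurePreserving (Prod.map id Prod.swap)
      ((volume.restrict (Set.Ioc (-Real.pi) Real.pi)).prod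
        ((volume.restrict (Set.Ioc (-Real.pi) Real.pi)).prod (volume.restrict (Set.Ioc (-Real.pi) Real.pi))))
      ((volume.restrict (Set.Ioc (-Real.pi) Real.pi)).prod
        ((volume.restrict (Set.Ioc (-Real.pi) Real.pi)).prod (volume.restrict (Set.Ioc (-Real.pi) Real.pi)))) :=
    (MeasurePreserving.id _).prod Measure.measurePreserving_swap
  have hfun : (fun q : ℝ × ℝ × ℝ => (q.1, q.2.2, q.2.1)) = Prod.map id Prod.swap := by
    funext q; rfl
  rw [hfun]
  exact h

/-- The swap of the two outer coordinates `(x,(y,z)) ↦ (y,(x,z))` preserves the cell measure.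
[folklore] -/
theorem cell_measurePreserving_swap12 :
    MeasurePreserving (fun q : ℝ × ℝ × ℝ => (q.2.1, q.1, q.2.2)) ((volume.restrict (Set.Ioc (-Real.pi) Real.pi)).prod ((volume.restrict (Set.Ioc (-Real.pi) Real.pi)).prod (volume.restrict (Set.Ioc (-Real.pi) Real.pi)))) ((volume.restrict (Set.Ioc (-Real.pi) Real.pi)).prod ((volume.restrict (Set.Ioc (-Real.pi) Real.pi)).prod (volume.restrict (Set.Ioc (-Real.pi) Real.pi)))) := by
  set ρ : Measure ℝ := volume.restrict (Set.Ioc (-Real.pi) Real.pi) with hρ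
  have h1 := measurePreserving_prodAssoc ρ ρ ρ
  have h2 : MeasurePreserving (Prod.map Prod.swap id) ((ρ.prod ρ).prod ρ) ((ρ.prod ρ).prod ρ) :=
    Measure.measurePreserving_swap.prod (MeasurePreserving.id _)
  have hfun : (fun q : ℝ × ℝ × ℝ => (q.2.1, q.1, q.2.2)) =
      (MeasurableEquiv.prodAssoc : (ℝ × ℝ) × ℝ ≃ᵐ ℝ × ℝ × ℝ) ∘ Prod.map Prod.swap id ∘
        (MeasurableEquiv.prodAssoc : (ℝ × ℝ) × ℝ ≃ᵐ ℝ × ℝ × ℝ).symm := by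
    funext q; rfl
  rw [hfun]
  exact h1.comp (h2.comp (h1.symm _))

/-! ### §2 Periodic integration by parts in the innermost coordinate -/

/-- The fibre map `t ↦ (x,(y,t))` has derivative `(0,(0,1))`. [folklore] -/
theorem cell_hasDerivAt_fibre₃ (x y t : ℝ) :
    HasDerivAt (fun t : ℝ => ((x, y, t) : ℝ × ℝ × ℝ)) ((0, 0, 1) : ℝ × ℝ × ℝ) t :=
  (hasDerivAt_const t x).prodMk ((hasDerivAt_const t y).prodMk (hasDerivAt_id t))

/-- Chain rule on a fibre: `d/dt f(x,y,t) = ∂₃ f (x,y,t)` for differentiable `f`. [folklore] -/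
theorem cell_hasDerivAt_comp_fibre₃ {f : ℝ × ℝ × ℝ → ℝ} (hf : Differentiable ℝ f) (x y t : ℝ) :
    HasDerivAt (fun t : ℝ => f (x, y, t)) (fderiv ℝ f (x, y, t) (0, 0, 1)) t :=
  (hf (x, y, t)).hasFDerivAt.comp_hasDerivAt t (cell_hasDerivAt_fibre₃ x y t)

/-- **Periodic integration by parts on one fibre.** For `C¹` functions `f, g : ℝ³ → ℝ` that are
`2π`-periodic in the last coordinate: `∫_{(−π,π]} f ∂₃g dt = −∫_{(−π,π]} ∂₃f g dt` along the fibre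
`t ↦ (x,(y,t))` (the boundary terms cancel). [folklore] -/
theorem cell_fibre_integral_mul_fderiv_eq_neg {f g : ℝ × ℝ × ℝ → ℝ} (hf : ContDiff ℝ 1 f)
    (hg : ContDiff ℝ 1 g) (hfp : ∀ p : ℝ × ℝ × ℝ, f (p.1, p.2.1, p.2.2 + 2 * π) = f p)
    (hgp : ∀ p : ℝ × ℝ × ℝ, g (p.1, p.2.1, p.2.2 + 2 * π) = g p) (x y : ℝ) :
    ∫ t in Set.Ioc (-π) π, f (x, y, t) * fderiv ℝ g (x, y, t) (0, 0, 1) =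
      -∫ t in Set.Ioc (-π) π, fderiv ℝ f (x, y, t) (0, 0, 1) * g (x, y, t) := by
  have hfd : Differentiable ℝ f := hf.differentiable one_ne_zero
  have hgd : Differentiable ℝ g := hg.differentiable one_ne_zero
  have hf'c : Continuous fun p => fderiv ℝ f p (0, 0, 1) :=
    (hf.continuous_fderiv one_ne_zero).clm_apply continuous_const
  have hg'c : Continuous fun p => fderiv ℝ g p (0, 0, 1) :=
    (hg.continuous_fderiv one_ne_zero).clm_apply continuous_const
  have hfib : Continuous fun t : ℝ => ((x, y, t) : ℝ × ℝ × ℝ) := by fun_prop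
  have hle : -π ≤ π := by linarith [Real.pi_pos]
  rw [← intervalIntegral.integral_of_le hle, ← intervalIntegral.integral_of_le hle]
  have hibp := intervalIntegral.integral_mul_deriv_eq_deriv_mul (a := -π) (b := π)
    (u := fun t => f (x, y, t)) (v := fun t => g (x, y, t))
    (u' := fun t => fderiv ℝ f (x, y, t) (0, 0, 1)) (v' := fun t => fderiv ℝ g (x, y, t) (0, 0, 1))
    (fun t _ => cell_hasDerivAt_comp_fibre₃ hfd x y t) (fun t _ => cell_hasDerivAt_comp_fibre₃ hgd x y t)
    ((hf'c.comp hfib).intervalIntegrable _ _) ((hg'c.comp hfib).intervalIntegrable _ _)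
  rw [hibp]
  -- the boundary terms cancel by periodicity
  have hfπ : f (x, y, π) = f (x, y, -π) := by
    have := hfp (x, y, -π); simp only at this; rw [← this]; congr 1; ring_nf
  have hgπ : g (x, y, π) = g (x, y, -π) := by
    have := hgp (x, y, -π); simp only at this; rw [← this]; congr 1; ring_nf
  rw [hfπ, hgπ, sub_self, zero_sub]

/-- **Periodic integration by parts in the innermost coordinate of the cell.** For `C¹` functions
`f, g : ℝ³ → ℝ`, `2π`-periodic in `p.2.2`: `∫ f ∂₃g dμc = −∫ ∂₃f g dμc`, `∂₃ = fderiv · (0,0,1)`.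
[folklore] -/
theorem cell_integral_mul_fderiv_inner_eq_neg {f g : ℝ × ℝ × ℝ → ℝ} (hf : ContDiff ℝ 1 f)
    (hg : ContDiff ℝ 1 g) (hfp : ∀ p : ℝ × ℝ × ℝ, f (p.1, p.2.1, p.2.2 + 2 * π) = f p)
    (hgp : ∀ p : ℝ × ℝ × ℝ, g (p.1, p.2.1, p.2.2 + 2 * π) = g p) :
    ∫ p, f p * fderiv ℝ g p (0, 0, 1) ∂((volume.restrict (Set.Ioc (-Real.pi) Real.pi)).prod ((volume.restrict (Set.Ioc (-Real.pi) Real.pi)).prod (volume.restrict (Set.Ioc (-Real.pi) Real.pi)))) = -∫ p, fderiv ℝ f p (0, 0, 1) * g p ∂((volume.restrict (Set.Ioc (-Real.pi) Real.pi)).prod ((volume.restrict (Set.Ioc (-Real.pi) Real.pi)).prod (volume.restrict (Set.Ioc (-Real.pi) Real.pi)))) := by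
  have hf'c : Continuous fun p => fderiv ℝ f p (0, 0, 1) :=
    (hf.continuous_fderiv one_ne_zero).clm_apply continuous_const
  have hg'c : Continuous fun p => fderiv ℝ g p (0, 0, 1) :=
    (hg.continuous_fderiv one_ne_zero).clm_apply continuous_const
  have hF₁ : Continuous fun p : ℝ × ℝ × ℝ => f p * fderiv ℝ g p (0, 0, 1) := hf.continuous.mul hg'c
  have hF₂ : Continuous fun p : ℝ × ℝ × ℝ => fderiv ℝ f p (0, 0, 1) * g p := hf'c.mul hg.continuous
  rw [← MourreDissolution.levelShift_integral_cell hF₁, ← MourreDissolution.levelShift_integral_cell hF₂,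
    ← integral_neg]
  refine setIntegral_congr_fun measurableSet_Ioc (fun x _ => ?_)
  rw [← integral_neg]
  refine setIntegral_congr_fun measurableSet_Ioc (fun y _ => ?_)
  exact cell_fibre_integral_mul_fderiv_eq_neg hf hg hfp hgp x y

/-! ### §3 The other two coordinate directions (transport by the swaps) -/

/-- The inner swap as a continuous linear map. -/
theorem cell_swap23_clm_apply (q : ℝ × ℝ × ℝ) :
    ((ContinuousLinearMap.fst ℝ ℝ (ℝ × ℝ)).prod
      (((ContinuousLinearMap.snd ℝ ℝ ℝ).comp (ContinuousLinearMap.snd ℝ ℝ (ℝ × ℝ))).prod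
        ((ContinuousLinearMap.fst ℝ ℝ ℝ).comp (ContinuousLinearMap.snd ℝ ℝ (ℝ × ℝ))))) q =
      (q.1, q.2.2, q.2.1) := rfl

/-- The outer swap as a continuous linear map. -/
theorem cell_swap12_clm_apply (q : ℝ × ℝ × ℝ) :
    (((ContinuousLinearMap.fst ℝ ℝ ℝ).comp (ContinuousLinearMap.snd ℝ ℝ (ℝ × ℝ))).prod
      ((ContinuousLinearMap.fst ℝ ℝ (ℝ × ℝ)).prod
        ((ContinuousLinearMap.snd ℝ ℝ ℝ).comp (ContinuousLinearMap.snd ℝ ℝ (ℝ × ℝ))))) q =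
      (q.2.1, q.1, q.2.2) := rfl

/-- Chain rule through the inner swap: `∂₃ (g ∘ swap23) (q) = ∂₂ g (swap23 q)`. [folklore] -/
theorem cell_fderiv_comp_swap23 {g : ℝ × ℝ × ℝ → ℝ} (hg : Differentiable ℝ g) (q : ℝ × ℝ × ℝ) :
    fderiv ℝ (fun q : ℝ × ℝ × ℝ => g (q.1, q.2.2, q.2.1)) q (0, 0, 1) =
      fderiv ℝ g (q.1, q.2.2, q.2.1) (0, 1, 0) := by
  set L := ((ContinuousLinearMap.fst ℝ ℝ (ℝ × ℝ)).prod
      (((ContinuousLinearMap.snd ℝ ℝ ℝ).comp (ContinuousLinearMap.snd ℝ ℝ (ℝ × ℝ))).prod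
        ((ContinuousLinearMap.fst ℝ ℝ ℝ).comp (ContinuousLinearMap.snd ℝ ℝ (ℝ × ℝ))))) with hL
  have hfun : (fun q : ℝ × ℝ × ℝ => g (q.1, q.2.2, q.2.1)) = g ∘ L := by
    funext q; simp only [Function.comp_apply, hL, cell_swap23_clm_apply]
  rw [hfun, ((hg (L q)).hasFDerivAt.comp q L.hasFDerivAt).fderiv]
  simp [hL]

/-- Chain rule through the outer swap: `∂₂ (g ∘ swap12) (q) = ∂₁ g (swap12 q)`. [folklore] -/
theorem cell_fderiv_comp_swap12 {g : ℝ × ℝ × ℝ → ℝ} (hg : Differentiable ℝ g) (q : ℝ × ℝ × ℝ) :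
    fderiv ℝ (fun q : ℝ × ℝ × ℝ => g (q.2.1, q.1, q.2.2)) q (0, 1, 0) =
      fderiv ℝ g (q.2.1, q.1, q.2.2) (1, 0, 0) := by
  set L := (((ContinuousLinearMap.fst ℝ ℝ ℝ).comp (ContinuousLinearMap.snd ℝ ℝ (ℝ × ℝ))).prod
      ((ContinuousLinearMap.fst ℝ ℝ (ℝ × ℝ)).prod
        ((ContinuousLinearMap.snd ℝ ℝ ℝ).comp (ContinuousLinearMap.snd ℝ ℝ (ℝ × ℝ))))) with hL
  have hfun : (fun q : ℝ × ℝ × ℝ => g (q.2.1, q.1, q.2.2)) = g ∘ L := by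
    funext q; simp only [Function.comp_apply, hL, cell_swap12_clm_apply]
  rw [hfun, ((hg (L q)).hasFDerivAt.comp q L.hasFDerivAt).fderiv]
  simp [hL]

/-- `C¹` is preserved by the inner swap. [folklore] -/
theorem cell_contDiff_comp_swap23 {g : ℝ × ℝ × ℝ → ℝ} {n : WithTop ℕ∞} (hg : ContDiff ℝ n g) :
    ContDiff ℝ n fun q : ℝ × ℝ × ℝ => g (q.1, q.2.2, q.2.1) :=
  hg.comp (contDiff_fst.prodMk ((contDiff_snd.comp contDiff_snd).prodMk (contDiff_fst.comp contDiff_snd)))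

/-- `C¹` is preserved by the outer swap. [folklore] -/
theorem cell_contDiff_comp_swap12 {g : ℝ × ℝ × ℝ → ℝ} {n : WithTop ℕ∞} (hg : ContDiff ℝ n g) :
    ContDiff ℝ n fun q : ℝ × ℝ × ℝ => g (q.2.1, q.1, q.2.2) :=
  hg.comp ((contDiff_fst.comp contDiff_snd).prodMk (contDiff_fst.prodMk (contDiff_snd.comp contDiff_snd)))

/-- **Periodic integration by parts in the middle coordinate of the cell.** For `C¹` functions
`f, g : ℝ³ → ℝ`, `2π`-periodic in `p.2.1`: `∫ f ∂₂g dμc = −∫ ∂₂f g dμc`, `∂₂ = fderiv · (0,1,0)`.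
[folklore] -/
theorem cell_integral_mul_fderiv_mid_eq_neg {f g : ℝ × ℝ × ℝ → ℝ} (hf : ContDiff ℝ 1 f)
    (hg : ContDiff ℝ 1 g) (hfp : ∀ p : ℝ × ℝ × ℝ, f (p.1, p.2.1 + 2 * π, p.2.2) = f p)
    (hgp : ∀ p : ℝ × ℝ × ℝ, g (p.1, p.2.1 + 2 * π, p.2.2) = g p) :
    ∫ p, f p * fderiv ℝ g p (0, 1, 0) ∂((volume.restrict (Set.Ioc (-Real.pi) Real.pi)).prod ((volume.restrict (Set.Ioc (-Real.pi) Real.pi)).prod (volume.restrict (Set.Ioc (-Real.pi) Real.pi)))) = -∫ p, fderiv ℝ f p (0, 1, 0) * g p ∂((volume.restrict (Set.Ioc (-Real.pi) Real.pi)).prod ((volume.restrict (Set.Ioc (-Real.pi) Real.pi)).prod (volume.restrict (Set.Ioc (-Real.pi) Real.pi)))) := by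
  have hσ := cell_measurePreserving_swap23
  have hσm : Measurable (fun q : ℝ × ℝ × ℝ => (q.1, q.2.2, q.2.1)) := hσ.measurable
  have hemb : MeasurableEmbedding (fun q : ℝ × ℝ × ℝ => (q.1, q.2.2, q.2.1)) := by
    have : (fun q : ℝ × ℝ × ℝ => (q.1, q.2.2, q.2.1)) =
        ((MeasurableEquiv.refl ℝ).prodCongr (MeasurableEquiv.prodComm : ℝ × ℝ ≃ᵐ ℝ × ℝ)) := by
      funext q; rfl
    rw [this]
    exact MeasurableEquiv.measurableEmbedding _
  -- transport both integrals through the swap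
  have hfd : Differentiable ℝ f := hf.differentiable one_ne_zero
  have hgd : Differentiable ℝ g := hg.differentiable one_ne_zero
  set F : ℝ × ℝ × ℝ → ℝ := fun q => f (q.1, q.2.2, q.2.1) with hF
  set G : ℝ × ℝ × ℝ → ℝ := fun q => g (q.1, q.2.2, q.2.1) with hG
  have hF1 : ContDiff ℝ 1 F := cell_contDiff_comp_swap23 hf
  have hG1 : ContDiff ℝ 1 G := cell_contDiff_comp_swap23 hg
  have hFp : ∀ p : ℝ × ℝ × ℝ, F (p.1, p.2.1, p.2.2 + 2 * π) = F p := fun p => by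
    simp only [hF]; exact hfp (p.1, p.2.2, p.2.1)
  have hGp : ∀ p : ℝ × ℝ × ℝ, G (p.1, p.2.1, p.2.2 + 2 * π) = G p := fun p => by
    simp only [hG]; exact hgp (p.1, p.2.2, p.2.1)
  have hinner := cell_integral_mul_fderiv_inner_eq_neg hF1 hG1 hFp hGp
  have hlhs : ∫ p, f p * fderiv ℝ g p (0, 1, 0) ∂((volume.restrict (Set.Ioc (-Real.pi) Real.pi)).prod ((volume.restrict (Set.Ioc (-Real.pi) Real.pi)).prod (volume.restrict (Set.Ioc (-Real.pi) Real.pi)))) = ∫ q, F q * fderiv ℝ G q (0, 0, 1) ∂((volume.restrict (Set.Ioc (-Real.pi) Real.pi)).prod ((volume.restrict (Set.Ioc (-Real.pi) Real.pi)).prod (volume.restrict (Set.Ioc (-Real.pi) Real.pi)))) := by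
    rw [← hσ.integral_comp hemb]
    refine integral_congr_ae (Eventually.of_forall fun q => ?_)
    simp only [hF, hG, cell_fderiv_comp_swap23 hgd]
  have hrhs : ∫ p, fderiv ℝ f p (0, 1, 0) * g p ∂((volume.restrict (Set.Ioc (-Real.pi) Real.pi)).prod ((volume.restrict (Set.Ioc (-Real.pi) Real.pi)).prod (volume.restrict (Set.Ioc (-Real.pi) Real.pi)))) = ∫ q, fderiv ℝ F q (0, 0, 1) * G q ∂((volume.restrict (Set.Ioc (-Real.pi) Real.pi)).prod ((volume.restrict (Set.Ioc (-Real.pi) Real.pi)).prod (volume.restrict (Set.Ioc (-Real.pi) Real.pi)))) := by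
    rw [← hσ.integral_comp hemb]
    refine integral_congr_ae (Eventually.of_forall fun q => ?_)
    simp only [hF, hG, cell_fderiv_comp_swap23 hfd]
  rw [hlhs, hrhs, hinner]

/-- **Periodic integration by parts in the first coordinate of the cell.** For `C¹` functions
`f, g : ℝ³ → ℝ`, `2π`-periodic in `p.1`: `∫ f ∂₁g dμc = −∫ ∂₁f g dμc`, `∂₁ = fderiv · (1,0,0)`.
[folklore] -/
theorem cell_integral_mul_fderiv_fst_eq_neg {f g : ℝ × ℝ × ℝ → ℝ} (hf : ContDiff ℝ 1 f)
    (hg : ContDiff ℝ 1 g) (hfp : ∀ p : ℝ × ℝ × ℝ, f (p.1 + 2 * π, p.2.1, p.2.2) = f p)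
    (hgp : ∀ p : ℝ × ℝ × ℝ, g (p.1 + 2 * π, p.2.1, p.2.2) = g p) :
    ∫ p, f p * fderiv ℝ g p (1, 0, 0) ∂((volume.restrict (Set.Ioc (-Real.pi) Real.pi)).prod ((volume.restrict (Set.Ioc (-Real.pi) Real.pi)).prod (volume.restrict (Set.Ioc (-Real.pi) Real.pi)))) = -∫ p, fderiv ℝ f p (1, 0, 0) * g p ∂((volume.restrict (Set.Ioc (-Real.pi) Real.pi)).prod ((volume.restrict (Set.Ioc (-Real.pi) Real.pi)).prod (volume.restrict (Set.Ioc (-Real.pi) Real.pi)))) := by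
  have hσ := cell_measurePreserving_swap12
  have hemb : MeasurableEmbedding (fun q : ℝ × ℝ × ℝ => (q.2.1, q.1, q.2.2)) := by
    have : (fun q : ℝ × ℝ × ℝ => (q.2.1, q.1, q.2.2)) =
        ((MeasurableEquiv.prodAssoc : (ℝ × ℝ) × ℝ ≃ᵐ ℝ × ℝ × ℝ) ∘
          ((MeasurableEquiv.prodComm : ℝ × ℝ ≃ᵐ ℝ × ℝ).prodCongr (MeasurableEquiv.refl ℝ)) ∘
          (MeasurableEquiv.prodAssoc : (ℝ × ℝ) × ℝ ≃ᵐ ℝ × ℝ × ℝ).symm) := by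
      funext q; rfl
    rw [this]
    exact (MeasurableEquiv.measurableEmbedding _).comp
      ((MeasurableEquiv.measurableEmbedding _).comp (MeasurableEquiv.measurableEmbedding _))
  have hfd : Differentiable ℝ f := hf.differentiable one_ne_zero
  have hgd : Differentiable ℝ g := hg.differentiable one_ne_zero
  set F : ℝ × ℝ × ℝ → ℝ := fun q => f (q.2.1, q.1, q.2.2) with hF
  set G : ℝ × ℝ × ℝ → ℝ := fun q => g (q.2.1, q.1, q.2.2) with hG
  have hF1 : ContDiff ℝ 1 F := cell_contDiff_comp_swap12 hf
  have hG1 : ContDiff ℝ 1 G := cell_contDiff_comp_swap12 hg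
  have hFp : ∀ p : ℝ × ℝ × ℝ, F (p.1, p.2.1 + 2 * π, p.2.2) = F p := fun p => by
    simp only [hF]; exact hfp (p.2.1, p.1, p.2.2)
  have hGp : ∀ p : ℝ × ℝ × ℝ, G (p.1, p.2.1 + 2 * π, p.2.2) = G p := fun p => by
    simp only [hG]; exact hgp (p.2.1, p.1, p.2.2)
  have hmid := cell_integral_mul_fderiv_mid_eq_neg hF1 hG1 hFp hGp
  have hlhs : ∫ p, f p * fderiv ℝ g p (1, 0, 0) ∂((volume.restrict (Set.Ioc (-Real.pi) Real.pi)).prod ((volume.restrict (Set.Ioc (-Real.pi) Real.pi)).prod (volume.restrict (Set.Ioc (-Real.pi) Real.pi)))) = ∫ q, F q * fderiv ℝ G q (0, 1, 0) ∂((volume.restrict (Set.Ioc (-Real.pi) Real.pi)).prod ((volume.restrict (Set.Ioc (-Real.pi) Real.pi)).prod (volume.restrict (Set.Ioc (-Real.pi) Real.pi)))) := by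
    rw [← hσ.integral_comp hemb]
    refine integral_congr_ae (Eventually.of_forall fun q => ?_)
    simp only [hF, hG, cell_fderiv_comp_swap12 hgd]
  have hrhs : ∫ p, fderiv ℝ f p (1, 0, 0) * g p ∂((volume.restrict (Set.Ioc (-Real.pi) Real.pi)).prod ((volume.restrict (Set.Ioc (-Real.pi) Real.pi)).prod (volume.restrict (Set.Ioc (-Real.pi) Real.pi)))) = ∫ q, fderiv ℝ F q (0, 1, 0) * G q ∂((volume.restrict (Set.Ioc (-Real.pi) Real.pi)).prod ((volume.restrict (Set.Ioc (-Real.pi) Real.pi)).prod (volume.restrict (Set.Ioc (-Real.pi) Real.pi)))) := by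
    rw [← hσ.integral_comp hemb]
    refine integral_congr_ae (Eventually.of_forall fun q => ?_)
    simp only [hF, hG, cell_fderiv_comp_swap12 hfd]
  rw [hlhs, hrhs, hmid]

/-! ### §4 The three directions packaged -/

/-- **Periodic integration by parts on the cell `(−π,π]³` in each coordinate direction (registered
sub-goal `cell_integral_mul_fderiv_eq_neg` of stub B1b″).** For `C¹` functions `f, g : ℝ³ → ℝ` that are
`2π`-periodic in each of the three coordinates and each coordinate vector
`e ∈ {(1,0,0), (0,1,0), (0,0,1)}`: `∫ f ∂ₑg dμc = −∫ ∂ₑf g dμc` on the period cell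
`μc = (vol|(−π,π])^{⊗3}`. [folklore] -/
theorem cell_integral_mul_fderiv_eq_neg :
    ∀ (f g : ℝ × ℝ × ℝ → ℝ), ContDiff ℝ 1 f → ContDiff ℝ 1 g →
      (∀ p : ℝ × ℝ × ℝ, f (p.1 + 2 * Real.pi, p.2.1, p.2.2) = f p) →
      (∀ p : ℝ × ℝ × ℝ, f (p.1, p.2.1 + 2 * Real.pi, p.2.2) = f p) →
      (∀ p : ℝ × ℝ × ℝ, f (p.1, p.2.1, p.2.2 + 2 * Real.pi) = f p) →
      (∀ p : ℝ × ℝ × ℝ, g (p.1 + 2 * Real.pi, p.2.1, p.2.2) = g p) →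
      (∀ p : ℝ × ℝ × ℝ, g (p.1, p.2.1 + 2 * Real.pi, p.2.2) = g p) →
      (∀ p : ℝ × ℝ × ℝ, g (p.1, p.2.1, p.2.2 + 2 * Real.pi) = g p) →
      ∀ e : ℝ × ℝ × ℝ, (e = (1, 0, 0) ∨ e = (0, 1, 0) ∨ e = (0, 0, 1)) →
        ∫ p, f p * fderiv ℝ g p e ∂((volume.restrict (Set.Ioc (-Real.pi) Real.pi)).prod
            ((volume.restrict (Set.Ioc (-Real.pi) Real.pi)).prod
              (volume.restrict (Set.Ioc (-Real.pi) Real.pi)))) =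
          -∫ p, fderiv ℝ f p e * g p ∂((volume.restrict (Set.Ioc (-Real.pi) Real.pi)).prod
            ((volume.restrict (Set.Ioc (-Real.pi) Real.pi)).prod
              (volume.restrict (Set.Ioc (-Real.pi) Real.pi)))) := by
  intro f g hf hg hf1 hf2 hf3 hg1 hg2 hg3 e he
  rcases he with rfl | rfl | rfl
  · exact cell_integral_mul_fderiv_fst_eq_neg hf hg hf1 hg1
  · exact cell_integral_mul_fderiv_mid_eq_neg hf hg hf2 hg2
  · exact cell_integral_mul_fderiv_inner_eq_neg hf hg hf3 hg3

end Summit.AtomisticToContinuum.FouriersLaw.Theorems.DrudeDissolution.KineticPolymerGasOnTheTimeAxis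

end
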